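import Mathlib.Analysis.Calculus.IteratedDeriv.Lemmas
import Mathlib.Analysis.Calculus.MeanValue
import Mathlib.Analysis.Analytic.Constructions
import Literature.Analysis.FluidPDE.SelfSimilar
import Literature.Analysis.FluidPDE.DongZhangTimeAnalyticityProofs
import Literature.Analysis.FluidPDE.NSBoundedMildAnalytic
import HarnessLib

/-!
# Route ClockStretchingLaw — `SteadySliceLiouville`: time analyticity and time-derivative bounds
# of bounded smooth KNSS-mild ancient solutions

Helper file for item stmt-NavierStokesRegularity-10572 (`SteadySliceLiouville`) of route
`ClockStretchingLaw` of `NavierStokesRegularity`. For a field `u : ℝ → ℝ³ → ℝ³`, smooth on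
`(-∞, 0) × ℝ³`, with the Type I bound `‖u(t,x)‖ ≤ C/√(-t)` (`HasTypeITimeDecay C u`) and solving
the KNSS-mild (Oseen) integral equation `u(t) = e^{(t-s)Δ}u(s) - B¹_s(u,u)(t)` for all
`s < t < 0` (`B = oseenDuhamel`), this file proves:

* `oseenDuhamel_one_eq_unfolded` — the route's written-out double integral (through
  `UnboundedOperators.heatKernel`) *is* `oseenDuhamel 1 s w w t x` (definitional unfolding of
  `oseenKernel`, `oseenWeightA`, `oseenWeightB`);
* `analyticOnNhd_uncurry_of_oseenMild` — **joint real-analyticity** of `uncurry u` on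
  `(-∞, 0) × ℝ³`: near every `t₁ < 0` restart at `s < t₁`; the local solution of Oseen's scheme
  from the bounded datum `u(s)` is jointly real-analytic (Lemarié-Rieusset 2016, Thm. 9.12, the
  proved local fact `lemarieRieusset2016_local_analyticity_holds`) and coincides with `u` on its
  window (uniqueness of bounded solutions, `oseenMild_bounded_unique`);
* `exists_bound_iteratedDeriv_two` — a **uniform bound on `∂ₜ²u`** on `[t₀, t₀ + h₀] × ℝ³`
  (Dong–Zhang 2020, §3 Thm. 2, the proved fact `DongZhang2020_timeDerivative_bounds_boundedMild_holds`,
  applied to a saturated time translate of `u` on a unit window ending before `0`);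

together with elementary consequences of the Type I bound and of smoothness (slice continuity,
derivatives of the time curves `t ↦ u(t,x)`).

## References

* H. Dong, Q. S. Zhang, *Time analyticity for the heat equation and Navier–Stokes equations*,
  J. Funct. Anal. 279 (2020) 108563 = arXiv:1907.01687, §3 Thm. 2.
* P. G. Lemarié-Rieusset, *The Navier–Stokes Problem in the 21st Century*, CRC Press 2016,
  Thm. 9.12.
* G. Koch, N. Nadirashvili, G. Seregin, V. Šverák, Acta Math. 203 (2009) = arXiv:0709.3599, §4.
-/

noncomputable section

open Literature.Analysis.FluidPDE MeasureTheory Set Function Filter Topology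
open Literature.Analysis.UnboundedOperators (heatExtension heatKernel)
open scoped ENNReal NNReal

namespace Summit.NavierStokesRegularity.NavierStokesRegularity.Theorems

/-! ### The KNSS-mild clause in the tree's Oseen architecture -/

/-- The Oseen clause of the route, folded: the double integral written out in the route's items
through `UnboundedOperators.heatKernel` is `B¹_s(w,w)(t)(x) = oseenDuhamel 1 s w w t x`
(definitional unfolding of `oseenKernel`, `oseenWeightA`, `oseenWeightB`; Koch–Tataru 2001, §2
(5)–(8)). -/
theorem oseenDuhamel_one_eq_unfolded (s t : ℝ) (w : ℝ → (EuclideanSpace ℝ (Fin 3)) → (EuclideanSpace ℝ (Fin 3))) (x : (EuclideanSpace ℝ (Fin 3))) :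
    oseenDuhamel 1 s w w t x = ∫ τ in Set.Ioo s t, ∫ y, ((-(inner ℝ (x - y) (w τ y) / (2 * (t - τ)) * Literature.Analysis.UnboundedOperators.heatKernel (t - τ) (x - y))) • w τ y + (∫ σ in Set.Ioi (t - τ), Literature.Analysis.UnboundedOperators.heatKernel σ (x - y) / (4 * σ ^ 2)) • (inner ℝ (x - y) (w τ y) • w τ y + inner ℝ (w τ y) (w τ y) • (x - y) + inner ℝ (x - y) (w τ y) • w τ y) - ((∫ σ in Set.Ioi (t - τ), Literature.Analysis.UnboundedOperators.heatKernel σ (x - y) / (8 * σ ^ 3)) * (inner ℝ (x - y) (w τ y) * inner ℝ (x - y) (w τ y))) • (x - y)) := by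
  rw [oseenDuhamel_apply]
  simp only [oseenKernel, oseenWeightA, oseenWeightB, one_mul]

/-! ### Elementary consequences of the Type I bound and of smoothness -/

section Basic

variable {C : ℝ} {u : ℝ → (EuclideanSpace ℝ (Fin 3)) → (EuclideanSpace ℝ (Fin 3))}

/-- The Type I constant of a field is nonnegative (evaluate the bound at `t = -1`). -/
theorem steadySlice_typeI_const_nonneg (hTI : HasTypeITimeDecay C u) : 0 ≤ C := by
  have h := hTI (-1) (by norm_num) 0
  rw [neg_neg, Real.sqrt_one, div_one] at h
  exact (norm_nonneg _).trans h

/-- A Type I field is bounded by `C/√(-T)` on `(-∞, T]`, `T < 0`. -/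
theorem steadySlice_norm_le_of_hasTypeITimeDecay (hTI : HasTypeITimeDecay C u) (hC : 0 ≤ C) {T τ : ℝ}
    (hT : T < 0) (hτ : τ ≤ T) (y : (EuclideanSpace ℝ (Fin 3))) : ‖u τ y‖ ≤ C / Real.sqrt (-T) :=
  (hTI τ (hτ.trans_lt hT) y).trans (div_le_div_of_nonneg_left hC (Real.sqrt_pos.2 (neg_pos.2 hT))
    (Real.sqrt_le_sqrt (by linarith)))

/-- Slices of a field smooth on `(-∞, 0) × ℝ³` are continuous. -/
theorem steadySlice_continuous_slice (hsm : ContDiffOn ℝ (⊤ : ℕ∞) (uncurry u) (Iio 0 ×ˢ univ)) {t : ℝ}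
    (ht : t < 0) : Continuous (u t) :=
  hsm.continuousOn.comp_continuous (f := fun y => (t, y)) (by fun_prop)
    fun y => mk_mem_prod ht (mem_univ _)

/-- Joint measurability of a time translate `u(· + h)` on a slab `(s, T) × ℝ³` with `T + h ≤ 0`. -/
theorem steadySlice_aestronglyMeasurable_translate (hsm : ContDiffOn ℝ (⊤ : ℕ∞) (uncurry u) (Iio 0 ×ˢ univ))
    {s T : ℝ} (h : ℝ) (hT : T + h ≤ 0) :
    AEStronglyMeasurable (uncurry fun τ => u (τ + h))
      ((volume : Measure (ℝ × (EuclideanSpace ℝ (Fin 3)))).restrict (Ioo s T ×ˢ univ)) := by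
  have hφ : Continuous fun p : ℝ × (EuclideanSpace ℝ (Fin 3)) => (p.1 + h, p.2) := by fun_prop
  have hmaps : MapsTo (fun p : ℝ × (EuclideanSpace ℝ (Fin 3)) => (p.1 + h, p.2)) (Ioo s T ×ˢ univ) (Iio 0 ×ˢ univ) := by
    intro p hp
    obtain ⟨hp1, -⟩ := mem_prod.1 hp
    exact mk_mem_prod (by simp only [mem_Iio]; linarith [hp1.2]) (mem_univ _)
  exact (hsm.continuousOn.comp hφ.continuousOn hmaps).aestronglyMeasurable
    (measurableSet_Ioo.prod MeasurableSet.univ)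

/-- The time curves `t ↦ u(t,x)` of a field smooth on `(-∞, 0) × ℝ³` are smooth on `(-∞, 0)`. -/
theorem steadySlice_contDiffOn_curve (hsm : ContDiffOn ℝ (⊤ : ℕ∞) (uncurry u) (Iio 0 ×ˢ univ)) (x : (EuclideanSpace ℝ (Fin 3))) :
    ContDiffOn ℝ (⊤ : ℕ∞) (fun t => u t x) (Iio 0) :=
  hsm.comp (contDiffOn_id.prodMk contDiffOn_const) fun _ ht => mk_mem_prod ht (mem_univ _)

/-- Derivatives of the time curves: `t ↦ u(t,x)` has derivative `deriv` and `deriv (u(·,x))` has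
derivative `iteratedDeriv 2 (u(·,x))` at every `t < 0`. -/
theorem steadySlice_hasDerivAt_curve (hsm : ContDiffOn ℝ (⊤ : ℕ∞) (uncurry u) (Iio 0 ×ˢ univ)) (x : (EuclideanSpace ℝ (Fin 3)))
    {t : ℝ} (ht : t < 0) :
    HasDerivAt (fun τ => u τ x) (deriv (fun τ => u τ x) t) t ∧
      HasDerivAt (deriv fun τ => u τ x) (iteratedDeriv 2 (fun τ => u τ x) t) t := by
  have hcd := steadySlice_contDiffOn_curve hsm x
  have hd1 : DifferentiableOn ℝ (fun τ => u τ x) (Iio 0) :=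
    hcd.differentiableOn (by simp)
  have hcd' : ContDiffOn ℝ (⊤ : ℕ∞) (deriv fun τ => u τ x) (Iio 0) :=
    hcd.deriv_of_isOpen isOpen_Iio (by exact_mod_cast le_top)
  have hd2 : DifferentiableOn ℝ (deriv fun τ => u τ x) (Iio 0) :=
    hcd'.differentiableOn (by simp)
  refine ⟨((hd1 t ht).differentiableAt (isOpen_Iio.mem_nhds ht)).hasDerivAt, ?_⟩
  have h2 := ((hd2 t ht).differentiableAt (isOpen_Iio.mem_nhds ht)).hasDerivAt
  rwa [show deriv (deriv fun τ => u τ x) t = iteratedDeriv 2 (fun τ => u τ x) t by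
    rw [iteratedDeriv_succ, iteratedDeriv_one]] at h2

end Basic

/-! ### Step 1: time analyticity -/

section Analytic

variable {C : ℝ} {u : ℝ → (EuclideanSpace ℝ (Fin 3)) → (EuclideanSpace ℝ (Fin 3))}

/-- **Joint real-analyticity of a bounded smooth KNSS-mild ancient solution** (Lemarié-Rieusset
2016, Thm. 9.12, through the proved local fact `lemarieRieusset2016_local_analyticity_holds` and
the uniqueness of bounded solutions of the Oseen integral equation,
`oseenMild_bounded_unique`): near `t₁ < 0`, restart at `s = t₁ - δ`; the local analytic solution
from `u(s)` equals `u` on `(s, T₂) ∋ t₁`. -/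
theorem analyticOnNhd_uncurry_of_oseenMild
    (hsm : ContDiffOn ℝ (⊤ : ℕ∞) (uncurry u) (Iio 0 ×ˢ univ))
    (hmildO : ∀ s t : ℝ, s < t → t < 0 → ∀ x,
      u t x = heatExtension (u s) (t - s) x - oseenDuhamel 1 s u u t x)
    (hTI : HasTypeITimeDecay C u) :
    AnalyticOnNhd ℝ (uncurry u) (Iio 0 ×ˢ (univ : Set (EuclideanSpace ℝ (Fin 3)))) := by
  obtain ⟨ε, hε, CL, -, hLoc⟩ := lemarieRieusset2016_local_analyticity_holds
  have hC : 0 ≤ C := steadySlice_typeI_const_nonneg hTI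
  have hcont : ContinuousOn (uncurry u) (Iio 0 ×ˢ univ) := hsm.continuousOn
  intro z hz
  obtain ⟨hz1, -⟩ := mem_prod.1 hz
  have ht₁ : z.1 < 0 := hz1
  -- a bound `M` on `(-∞, z.1/2]`
  set M : ℝ := C / Real.sqrt (-(z.1 / 2)) + 1 with hM
  have hM0 : 0 < M := by
    have : 0 ≤ C / Real.sqrt (-(z.1 / 2)) := div_nonneg hC (Real.sqrt_nonneg _)
    linarith
  have hbdM : ∀ τ ≤ z.1 / 2, ∀ y, ‖u τ y‖ ≤ M := fun τ hτ y =>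
    (steadySlice_norm_le_of_hasTypeITimeDecay hTI hC (by linarith) hτ y).trans (by linarith)
  -- the window
  set h : ℝ := ε * 1 / M ^ 2 with hh
  have hh0 : 0 < h := by positivity
  set δ : ℝ := min (h / 2) (-z.1 / 4) with hδ
  have hδ0 : 0 < δ := lt_min (by linarith) (by linarith)
  have hδh : δ ≤ h / 2 := min_le_left _ _
  have hδz : δ ≤ -z.1 / 4 := min_le_right _ _
  set s : ℝ := z.1 - δ with hs
  set T₂ : ℝ := min (s + h) (z.1 / 2) with hT₂
  have hst₁ : s < z.1 := by linarith
  have ht₁T₂ : z.1 < T₂ := lt_min (by linarith) (by linarith)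
  have hT₂h : T₂ ≤ s + h := min_le_left _ _
  have hT₂z : T₂ ≤ z.1 / 2 := min_le_right _ _
  have hT₂0 : T₂ < 0 := by linarith
  have hs0 : s < 0 := by linarith
  -- the datum `u s`
  have ha : AEStronglyMeasurable (u s) volume := (steadySlice_continuous_slice hsm hs0).aestronglyMeasurable
  have haM : eLpNorm (u s) ∞ volume ≤ ENNReal.ofReal M := by
    rw [eLpNorm_exponent_top]
    exact eLpNormEssSup_le_of_ae_bound (Eventually.of_forall fun y => hbdM s (by linarith) y)
  obtain ⟨v, hvan, hveq, hvbd⟩ := hLoc one_pos s hM0 ha haM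
  -- uniqueness of bounded solutions on `(s, T₂)`
  have hmax0 : 0 ≤ max M (CL * M) := hM0.le.trans (le_max_left _ _)
  have hum : AEStronglyMeasurable (uncurry u)
      ((volume : Measure (ℝ × (EuclideanSpace ℝ (Fin 3)))).restrict (Ioo s T₂ ×ˢ univ)) :=
    (hcont.mono (prod_mono (fun τ hτ => (hτ.2.trans hT₂0 : τ < 0)) Subset.rfl)).aestronglyMeasurable
      (measurableSet_Ioo.prod MeasurableSet.univ)
  have hvm : AEStronglyMeasurable (uncurry v)
      ((volume : Measure (ℝ × (EuclideanSpace ℝ (Fin 3)))).restrict (Ioo s T₂ ×ˢ univ)) :=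
    (hvan.continuousOn.mono (prod_mono (Ioo_subset_Ioo_right hT₂h) Subset.rfl)).aestronglyMeasurable
      (measurableSet_Ioo.prod MeasurableSet.univ)
  have huniq : ∀ t ∈ Ioo s T₂, u t =ᵐ[volume] v t :=
    oseenMild_bounded_unique (ν := 1) (s := s) (T := T₂) (M := max M (CL * M)) (u := u) (v := v)
      (U := fun t x => heatExtension (u s) (t - s) x) one_pos hmax0 hum hvm
      (fun τ hτ y => (hbdM τ (hτ.2.le.trans hT₂z) y).trans (le_max_left _ _))
      (fun τ hτ y => (hvbd τ ⟨hτ.1, hτ.2.trans_le hT₂h⟩ y).trans (le_max_right _ _))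
      (fun t ht => Eventually.of_forall (hmildO s t ht.1 (ht.2.trans hT₂0)))
      (fun t ht => Eventually.of_forall fun x => by
        have h1 := hveq t ⟨ht.1, ht.2.trans_le hT₂h⟩ x
        rwa [one_mul] at h1)
  have hueq : ∀ t ∈ Ioo s T₂, u t = v t := by
    intro t ht
    have hcu : Continuous (u t) := steadySlice_continuous_slice hsm (ht.2.trans hT₂0)
    have hcv : Continuous (v t) :=
      hvan.continuousOn.comp_continuous (f := fun y => (t, y)) (by fun_prop)
        fun y => mk_mem_prod ⟨ht.1, ht.2.trans_le hT₂h⟩ (mem_univ _)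
    exact (Continuous.ae_eq_iff_eq volume hcu hcv).1 (huniq t ht)
  -- analyticity at `z`
  have hzw : z ∈ Ioo s T₂ ×ˢ (univ : Set (EuclideanSpace ℝ (Fin 3))) := mem_prod.2 ⟨⟨hst₁, ht₁T₂⟩, mem_univ _⟩
  have hzv : z ∈ Ioo s (s + ε * 1 / M ^ 2) ×ˢ (univ : Set (EuclideanSpace ℝ (Fin 3))) :=
    mem_prod.2 ⟨⟨hst₁, ht₁T₂.trans_le hT₂h⟩, mem_univ _⟩
  refine (hvan z hzv).congr ?_
  filter_upwards [(isOpen_Ioo.prod isOpen_univ).mem_nhds hzw] with y hy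
  obtain ⟨hy1, -⟩ := mem_prod.1 hy
  change v y.1 y.2 = u y.1 y.2
  rw [hueq y.1 hy1]

end Analytic

/-! ### Step 2: a uniform bound on `∂ₜ²u` near `t₀` (Dong–Zhang 2020) -/

section SecondDerivative

variable {C : ℝ} {u : ℝ → (EuclideanSpace ℝ (Fin 3)) → (EuclideanSpace ℝ (Fin 3))}

/-- **Uniform bound on the second time derivative near a time `t₀ < 0`** (Dong–Zhang 2020, §3
Thm. 2, `DongZhang2020_timeDerivative_bounds_boundedMild_holds`, case `n = 2`). The fact is applied
to the field `w(t, x) = u(min(t + T₁, T₂), x)` with `T₁ = t₀ - 1 + ε₀`, `T₁ + 1 < T₂ < 0`: on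
`[0, 1]` it is the time translate `u(· + T₁)` (a bounded, divergence-free, smooth KNSS-mild solution
by time translation of the Duhamel term, `oseenDuhamel_translate`), and it is globally continuous,
hence measurable. -/
theorem exists_bound_iteratedDeriv_two
    (hsm : ContDiffOn ℝ (⊤ : ℕ∞) (uncurry u) (Iio 0 ×ˢ univ))
    (hdiv : ∀ t < 0, VectorCalculus.IsDivFree (u t))
    (hmildO : ∀ s t : ℝ, s < t → t < 0 → ∀ x,
      u t x = heatExtension (u s) (t - s) x - oseenDuhamel 1 s u u t x)
    (hTI : HasTypeITimeDecay C u) {t₀ : ℝ} (ht₀ : t₀ < 0) :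
    ∃ A₂ h₀ : ℝ, 0 < h₀ ∧ t₀ + h₀ < 0 ∧
      ∀ t ∈ Icc t₀ (t₀ + h₀), ∀ x, ‖iteratedDeriv 2 (fun s => u s x) t‖ ≤ A₂ := by
  have hC : 0 ≤ C := steadySlice_typeI_const_nonneg hTI
  have hcont : ContinuousOn (uncurry u) (Iio 0 ×ˢ univ) := hsm.continuousOn
  -- the unit window `[T₁, T₁ + 1] ∋ t₀` ending before `0`
  set ε₀ : ℝ := min (-t₀ / 2) (1 / 2) with hε₀
  have hε₀0 : 0 < ε₀ := lt_min (by linarith) (by norm_num)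
  have hε₀le : ε₀ ≤ 1 / 2 := min_le_right _ _
  have hε₀t : ε₀ ≤ -t₀ / 2 := min_le_left _ _
  set T₁ : ℝ := t₀ - 1 + ε₀ with hT₁
  have hT₁1 : T₁ + 1 < 0 := by rw [hT₁]; linarith
  set T₂ : ℝ := (T₁ + 1) / 2 with hT₂
  have hT₂0 : T₂ < 0 := by rw [hT₂]; linarith
  have hT₁T₂ : T₁ + 1 < T₂ := by rw [hT₂]; linarith
  -- the translated, saturated field
  set w : ℝ → (EuclideanSpace ℝ (Fin 3)) → (EuclideanSpace ℝ (Fin 3)) := fun t x => u (min (t + T₁) T₂) x with hw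
  have hφ : Continuous fun p : ℝ × (EuclideanSpace ℝ (Fin 3)) => (min (p.1 + T₁) T₂, p.2) := by fun_prop
  have hφmem : ∀ p : ℝ × (EuclideanSpace ℝ (Fin 3)), (min (p.1 + T₁) T₂, p.2) ∈ Iio (0 : ℝ) ×ˢ (univ : Set (EuclideanSpace ℝ (Fin 3))) :=
    fun p => mk_mem_prod ((min_le_right _ _).trans_lt hT₂0) (mem_univ _)
  have hwcont : Continuous (uncurry w) := hcont.comp_continuous hφ hφmem
  have hw_eq : ∀ t : ℝ, t + T₁ ≤ T₂ → w t = u (t + T₁) := by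
    intro t ht
    show (fun x => u (min (t + T₁) T₂) x) = u (t + T₁)
    rw [min_eq_left ht]
  -- the hypotheses of the fact for `w`
  have hdiv' : ∀ t ∈ Ioo (0 : ℝ) 1, VectorCalculus.IsDivFree (w t) := by
    intro t ht
    rw [hw_eq t (by linarith [ht.2])]
    exact hdiv _ (by linarith [ht.2])
  have hbd' : ∀ t ∈ Icc (0 : ℝ) 1, ∀ x, ‖w t x‖ ≤ C / Real.sqrt (-(T₁ + 1)) := by
    intro t ht x
    rw [hw_eq t (by linarith [ht.2])]
    exact steadySlice_norm_le_of_hasTypeITimeDecay hTI hC hT₁1 (by linarith [ht.2]) x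
  have hmild' : ∀ s t : ℝ, 0 ≤ s → s < t → t ≤ 1 → ∀ x,
      w t x = heatFlow (w s) (t - s) x - ∫ τ in Set.Ioo s t, ∫ y, ((-(inner ℝ (x - y) (w τ y) / (2 * (t - τ)) * Literature.Analysis.UnboundedOperators.heatKernel (t - τ) (x - y))) • w τ y + (∫ σ in Set.Ioi (t - τ), Literature.Analysis.UnboundedOperators.heatKernel σ (x - y) / (4 * σ ^ 2)) • (inner ℝ (x - y) (w τ y) • w τ y + inner ℝ (w τ y) (w τ y) • (x - y) + inner ℝ (x - y) (w τ y) • w τ y) - ((∫ σ in Set.Ioi (t - τ), Literature.Analysis.UnboundedOperators.heatKernel σ (x - y) / (8 * σ ^ 3)) * (inner ℝ (x - y) (w τ y) * inner ℝ (x - y) (w τ y))) • (x - y)) := by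
    intro s t hs hst ht1 x
    rw [← oseenDuhamel_one_eq_unfolded, heatFlow_of_pos _ (sub_pos.2 hst)]
    have hws : w s = u (s + T₁) := hw_eq s (by linarith)
    have hwt : w t x = u (t + T₁) x := by rw [hw_eq t (by linarith)]
    have hB : oseenDuhamel 1 s w w t x =
        oseenDuhamel 1 s (fun τ => u (τ + T₁)) (fun τ => u (τ + T₁)) t x := by
      refine oseenDuhamel_congr_ae_slice (fun τ hτ => ?_) (fun τ hτ => ?_) x <;>
        · rw [hw_eq τ (by linarith [hτ.2])]
    rw [hwt, hws, hB, oseenDuhamel_translate 1 s T₁ u u t x,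
      hmildO (s + T₁) (t + T₁) (by linarith) (by linarith) x, add_sub_add_right_eq_sub]
  have hsm' : ContDiffOn ℝ (⊤ : ℕ∞) (uncurry w) (Ioo (0 : ℝ) 1 ×ˢ univ) := by
    have hψ : ContDiff ℝ (⊤ : ℕ∞) fun p : ℝ × (EuclideanSpace ℝ (Fin 3)) => (p.1 + T₁, p.2) := by fun_prop
    have h1 : ContDiffOn ℝ (⊤ : ℕ∞) (uncurry u ∘ fun p : ℝ × (EuclideanSpace ℝ (Fin 3)) => (p.1 + T₁, p.2))
        (Ioo (0 : ℝ) 1 ×ˢ univ) := by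
      refine hsm.comp hψ.contDiffOn fun p hp => ?_
      obtain ⟨hp1, -⟩ := mem_prod.1 hp
      exact mk_mem_prod (by simp only [mem_Iio]; linarith [hp1.2]) (mem_univ _)
    refine h1.congr fun p hp => ?_
    obtain ⟨hp1, -⟩ := mem_prod.1 hp
    show u (min (p.1 + T₁) T₂) p.2 = u (p.1 + T₁) p.2
    rw [min_eq_left (by linarith [hp1.2])]
  obtain ⟨N, hN1, hN⟩ := DongZhang2020_timeDerivative_bounds_boundedMild_holds 3 w
    (C / Real.sqrt (-(T₁ + 1))) (by norm_num) hwcont.measurable hdiv' hbd' hmild' hsm'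
  -- extraction: `n = 2` on `[t₀, t₀ + ε₀/2] = T₁ + [1 - ε₀, 1 - ε₀/2]`
  refine ⟨4 * (N ^ 3 * 4), ε₀ / 2, half_pos hε₀0, by linarith, fun t ht x => ?_⟩
  have ht' : t - T₁ ∈ Ioo (0 : ℝ) 1 := ⟨by rw [hT₁]; linarith [ht.1], by rw [hT₁]; linarith [ht.2]⟩
  have hhalf : 1 / 2 ≤ t - T₁ := by rw [hT₁]; linarith [ht.1]
  have key := hN 2 (by norm_num) (t - T₁) ht' x
  have hev : (fun s => w s x) =ᶠ[𝓝 (t - T₁)] fun s => u (s + T₁) x := by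
    have hmem : Iio (T₂ - T₁) ∈ 𝓝 (t - T₁) := Iio_mem_nhds (by linarith [ht.2])
    filter_upwards [hmem] with s hs
    show u (min (s + T₁) T₂) x = u (s + T₁) x
    rw [min_eq_left (by linarith [mem_Iio.1 hs])]
  have hD : iteratedDeriv 2 (fun s => w s x) (t - T₁) = iteratedDeriv 2 (fun s => u s x) t := by
    rw [(hev.iteratedDeriv 2).eq_of_nhds, iteratedDeriv_comp_add_const 2 (fun s => u s x) T₁]
    simp only [sub_add_cancel]
  rw [hD] at key
  have key' : (t - T₁) ^ 2 * ‖iteratedDeriv 2 (fun s => u s x) t‖ ≤ N ^ 3 * 4 := by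
    have h4 : (N : ℝ) ^ (2 + 1) * ((2 : ℕ) : ℝ) ^ (2 : ℕ) = N ^ 3 * 4 := by norm_num
    rw [h4] at key
    exact key
  have hnn := norm_nonneg (iteratedDeriv 2 (fun s => u s x) t)
  have hsq : 1 / 4 ≤ (t - T₁) ^ 2 := by nlinarith
  calc ‖iteratedDeriv 2 (fun s => u s x) t‖ = 4 * (1 / 4 * ‖iteratedDeriv 2 (fun s => u s x) t‖) := by
        ring
    _ ≤ 4 * ((t - T₁) ^ 2 * ‖iteratedDeriv 2 (fun s => u s x) t‖) := by gcongr
    _ ≤ 4 * (N ^ 3 * 4) := by gcongr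

end SecondDerivative

end Summit.NavierStokesRegularity.NavierStokesRegularity.Theorems

end
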